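import Summits.ResolutionOfSingularities.ResolutionOfSingularities.Theses.FrobeniusClosing
import Summits.ResolutionOfSingularities.ResolutionOfSingularities.Theses.JacobianBudget
import HarnessLib

/-!
# Crux `BoundedMilnor` (stmt-ResolutionOfSingularities-16346) — companion of line `jacobian-budget`:
# the cross-route theorems (TRANSFER from / to the sibling crux `JacobianBudget.IsolatedJacobianDrop`, stmt-18946)

Kept apart from the registered skeleton `Lines/jacobian_budget.lean` (which imports only this crux's
route file) because this file must import BOTH route files `Theses.FrobeniusClosing` and
`Theses.JacobianBudget`, and gate rewrites of either would otherwise break the registered skeleton.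
Self-contained: the two stub STATEMENTS of line `jacobian-budget` are restated here verbatim as
`NoExcess` / `Conservation` (syntactically the registered signatures of `stub_noExcess` /
`stub_conservation`), nothing is `sorry`d, and both theorems below are closed
(axioms ⊆ {propext, Classical.choice, Quot.sound}):

* `IsolatedJacobianDrop_of : NoExcess → Conservation → JacobianBudget.IsolatedJacobianDrop` — the
  sibling crux BY NAME from the same two statements (so ONE proof of the two registered stubs closes
  stmt-18946 as well as stmt-16346), via `run c₀ i t (m+1) = step (i m) (t m) (run c₀ i t m)` (rfl);
* `boundedMilnor_of_isolatedJacobianDrop : JacobianBudget.IsolatedJacobianDrop →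
  FrobeniusClosing.BoundedMilnor` — the TRANSFER CERTIFICATE: the sibling crux alone decides this crux
  (a one-step decrement forbids any rise of `μ` along an infinite isolated chain; `β := μ(a_0)`).
-/

set_option linter.dupNamespace false
set_option linter.unusedVariables false

noncomputable section

open Summit.ResolutionOfSingularities.ResolutionOfSingularities.Theses

namespace Summit.ResolutionOfSingularities.ResolutionOfSingularities.Cruxes.BoundedMilnor.Lines.JacobianBudgetTransfer.Companion

/-- Statement of `stub_noExcess` of line `jacobian-budget` (verbatim). [cite: arXiv:1802.05010, §1;
doi:10.1007/bfb0062814] -/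
def NoExcess : Prop :=
  ∀ p : ℕ, p.Prime → ∀ n : ℕ, 0 < n → ∀ (κ : Type) [Field κ] [CharP κ p] [PerfectField κ] (c : (Fin n → ℕ) → κ) (i : Fin n) (τ : Fin n → κ), let clean : ((Fin n → ℕ) → κ) → ((Fin n → ℕ) → κ) := fun c A => @ite κ (∀ j, p ∣ A j) (Classical.dec _) 0 (c A); let bl : Fin n → ((Fin n → ℕ) → κ) → ((Fin n → ℕ) → κ) := fun i c B => @ite κ (Finset.sum (Finset.univ.erase i) (fun j => B j) ≤ B i) (Classical.dec _) (c (Function.update B i (B i - Finset.sum (Finset.univ.erase i) (fun j => B j)))) 0; let ord : ((Fin n → ℕ) → κ) → ℕ := fun c => sInf {m : ℕ | ∃ A, c A ≠ 0 ∧ m = Finset.sum Finset.univ (fun j => A j)}; let dv : Fin n → ℕ → ((Fin n → ℕ) → κ) → ((Fin n → ℕ) → κ) := fun i s c B => c (Function.update B i (B i + s)); let tr : Fin n → (Fin n → κ) → ℕ → ((Fin n → ℕ) → κ) → ((Fin n → ℕ) → κ) := fun i τ s c B => Finset.sum (Fintype.piFinset (fun _ : Fin n => Finset.range (B i + s + 1)))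 (fun D => @ite κ (D i = 0) (Classical.dec _) (c (B + D) * Finset.prod (Finset.univ.erase i) (fun j => ((Nat.choose (B j + D j) (B j) : ℕ) : κ) * τ j ^ (D j))) 0); let step : Fin n → (Fin n → κ) → ((Fin n → ℕ) → κ) → ((Fin n → ℕ) → κ) := fun i τ c => clean (tr i τ (@ite ℕ (p ≤ ord (clean c)) (Classical.dec _) p 0) (dv i (@ite ℕ (p ≤ ord (clean c)) (Classical.dec _) p 0) (bl i (clean c)))); let run : ((Fin n → ℕ) → κ) → (ℕ → Fin n) → (ℕ → Fin n → κ) → ℕ → ((Fin n → ℕ) → κ) := fun c₀ i t m => @Nat.rec (fun _ => (Fin n → ℕ) → κ) c₀ (fun m c => step (i m) (t m) c) m; let ser : ((Fin n → ℕ) → κ) → MvPowerSeries (Fin n) κ := fun c => show MvPowerSeries (Fin n) κ from fun A : Fin n →₀ ℕ => clean c ⇑A; let pd : Fin n → MvPowerSeries (Fin n) κ → MvPowerSeries (Fin n) κ := fun i f => show MvPowerSeries (Fin n) κ from fun A : Fin n →₀ ℕ => ((A i + 1 : ℕ) : κ) * f (A + Finsupp.single i 1); let jac : ((Fin n → ℕ)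 → κ) → Ideal (MvPowerSeries (Fin n) κ) := fun c => Ideal.span (Set.range (fun i => pd i (ser c))); let Isol : ((Fin n → ℕ) → κ) → Prop := fun c => Module.Finite κ (MvPowerSeries (Fin n) κ ⧸ jac c); let MultP : ((Fin n → ℕ) → κ) → Prop := fun c => (∃ A, clean c A ≠ 0) ∧ ∀ A, clean c A ≠ 0 → p ≤ Finset.sum Finset.univ (fun j => A j); let mu : ((Fin n → ℕ) → κ) → ℕ := fun c => Module.finrank κ (MvPowerSeries (Fin n) κ ⧸ jac c); let hom : ℕ → ((Fin n → ℕ) → κ) → MvPolynomial (Fin n) κ := fun d c => Finset.sum (Fintype.piFinset (fun _ : Fin n => Finset.range (d + 1))) (fun A => @ite (MvPolynomial (Fin n) κ) (Finset.sum Finset.univ (fun j => A j) = d) (Classical.dec _) (MvPolynomial.monomial (Finsupp.equivFunOnFinite.symm A) (clean c A)) 0); let excI : ((Fin n → ℕ) → κ) → Ideal (MvPolynomial (Fin n) κ) := fun c => Ideal.span (insert (hom (p + 1) c) (Set.range (fun j : Fin n => MvPolynomial.pderiv j (hom p c)))); let ExcFinite : ((Fin n → ℕ) → κ) → Prop :=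 fun c => ∀ j : Fin n, Module.Finite κ (MvPolynomial (Fin n) κ ⧸ (excI c ⊔ Ideal.span {MvPolynomial.X j - 1})); let Δ : ℕ := ((p - 1) ^ n * (p + 1) + 1 - 2 * ((n + 1) % 2)) / p; MultP c → Isol (step i τ c) → MultP (step i τ c) → ExcFinite c

/-- Statement of `stub_conservation` of line `jacobian-budget` (verbatim). [cite: doi:10.1007/bfb0062814;
doi:10.1070/im1976v010n06abeh001833] -/
def Conservation : Prop :=
  ∀ p : ℕ, p.Prime → ∀ n : ℕ, 0 < n → ∀ (κ : Type) [Field κ] [CharP κ p] [PerfectField κ] (c : (Fin n → ℕ) → κ), let clean : ((Fin n → ℕ) → κ) → ((Fin n → ℕ) → κ) := fun c A => @ite κ (∀ j, p ∣ A j) (Classical.dec _) 0 (c A); let bl : Fin n → ((Fin n → ℕ) → κ) → ((Fin n → ℕ) → κ) := fun i c B => @ite κ (Finset.sum (Finset.univ.erase i) (fun j => B j) ≤ B i) (Classical.dec _) (c (Function.update B i (B i - Finset.sum (Finset.univ.erase i) (fun j => B j)))) 0; let ord : ((Fin n → ℕ) → κ) → ℕ := fun c => sInf {m : ℕ | ∃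 A, c A ≠ 0 ∧ m = Finset.sum Finset.univ (fun j => A j)}; let dv : Fin n → ℕ → ((Fin n → ℕ) → κ) → ((Fin n → ℕ) → κ) := fun i s c B => c (Function.update B i (B i + s)); let tr : Fin n → (Fin n → κ) → ℕ → ((Fin n → ℕ) → κ) → ((Fin n → ℕ) → κ) := fun i τ s c B => Finset.sum (Fintype.piFinset (fun _ : Fin n => Finset.range (B i + s + 1))) (fun D => @ite κ (D i = 0) (Classical.dec _) (c (B + D) * Finset.prod (Finset.univ.erase i) (fun j => ((Nat.choose (B j + D j) (B j) : ℕ) : κ) * τ j ^ (D j))) 0); let step : Fin n → (Fin n → κ) → ((Fin n → ℕ) → κ) → ((Fin n → ℕ) → κ) := fun i τ c => clean (tr i τ (@ite ℕ (p ≤ ord (clean c)) (Classical.dec _) p 0) (dv i (@ite ℕ (p ≤ ord (clean c)) (Classical.dec _) p 0) (bl i (clean c)))); let run : ((Fin n → ℕ) → κ) → (ℕ → Fin n) → (ℕ → Fin n → κ) → ℕ → ((Fin n → ℕ) → κ) := fun c₀ i t m => @Nat.rec (fun _ => (Fin n → ℕ) → κ) c₀ (fun m c => step (i m) (t m) c)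 m; let ser : ((Fin n → ℕ) → κ) → MvPowerSeries (Fin n) κ := fun c => show MvPowerSeries (Fin n) κ from fun A : Fin n →₀ ℕ => clean c ⇑A; let pd : Fin n → MvPowerSeries (Fin n) κ → MvPowerSeries (Fin n) κ := fun i f => show MvPowerSeries (Fin n) κ from fun A : Fin n →₀ ℕ => ((A i + 1 : ℕ) : κ) * f (A + Finsupp.single i 1); let jac : ((Fin n → ℕ) → κ) → Ideal (MvPowerSeries (Fin n) κ) := fun c => Ideal.span (Set.range (fun i => pd i (ser c))); let Isol : ((Fin n → ℕ) → κ) → Prop := fun c => Module.Finite κ (MvPowerSeries (Fin n) κ ⧸ jac c); let MultP : ((Fin n → ℕ) → κ) → Prop := fun c => (∃ A, clean c A ≠ 0) ∧ ∀ A, clean c A ≠ 0 → p ≤ Finset.sum Finset.univ (fun j => A j); let mu : ((Fin n → ℕ) → κ) → ℕ := fun c => Module.finrank κ (MvPowerSeries (Fin n) κ ⧸ jac c); let hom : ℕ → ((Fin n → ℕ) → κ) → MvPolynomial (Fin n) κ := fun d c => Finset.sum (Fintype.piFinset (fun _ : Fin n => Finset.range (d + 1))) (fun A => @ite (MvPolynomial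 (Fin n) κ) (Finset.sum Finset.univ (fun j => A j) = d) (Classical.dec _) (MvPolynomial.monomial (Finsupp.equivFunOnFinite.symm A) (clean c A)) 0); let excI : ((Fin n → ℕ) → κ) → Ideal (MvPolynomial (Fin n) κ) := fun c => Ideal.span (insert (hom (p + 1) c) (Set.range (fun j : Fin n => MvPolynomial.pderiv j (hom p c)))); let ExcFinite : ((Fin n → ℕ) → κ) → Prop := fun c => ∀ j : Fin n, Module.Finite κ (MvPolynomial (Fin n) κ ⧸ (excI c ⊔ Ideal.span {MvPolynomial.X j - 1})); let Δ : ℕ := ((p - 1) ^ n * (p + 1) + 1 - 2 * ((n + 1) % 2)) / p; Isol c → MultP c → ExcFinite c → ∀ (i : Fin n) (τ : Fin n → κ), mu (step i τ c) + Δ ≤ mu c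

/-- **The sibling crux `JacobianBudget.IsolatedJacobianDrop` (stmt-18946) from the two stub
statements of line `jacobian-budget`**, by name. [folklore] -/
theorem IsolatedJacobianDrop_of : NoExcess → Conservation → JacobianBudget.IsolatedJacobianDrop := by
  intro hNE hC p hp n hn κ _ _ _ c₀ i t
  intro clean bl ord dv tr step run ser pd jac Isol MultP mu Δ m hI hM hI' hM'
  exact hC p hp n hn κ (run c₀ i t m) hI hM (hNE p hp n hn κ (run c₀ i t m) (i m) (t m) hM hI' hM') (i m) (t m)

/-- **TRANSFER CERTIFICATE.** `JacobianBudget.IsolatedJacobianDrop` (stmt-18946, a registered route item)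
implies `FrobeniusClosing.BoundedMilnor` (stmt-16346) outright. [folklore] -/
theorem boundedMilnor_of_isolatedJacobianDrop (hD : JacobianBudget.IsolatedJacobianDrop) :
    FrobeniusClosing.BoundedMilnor := by
  intro p hp n hn κ _ _ _ c₀ i t
  have hD' := hD p hp n hn κ c₀ i t
  intro clean bl ord dv tr step run ser pd jac Isol MultP mu hchain
  have hmono : ∀ m, mu (run c₀ i t (m + 1)) ≤ mu (run c₀ i t m) := fun m =>
    le_trans (Nat.le_add_right _ _)
      (hD' m (hchain m).1 (hchain m).2 (hchain (m + 1)).1 (hchain (m + 1)).2)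
  refine ⟨mu (run c₀ i t 0), fun m => ?_⟩
  induction m with
  | zero => exact le_rfl
  | succ m ih => exact (hmono m).trans ih

/-- Both cruxes at once from the two stub statements. [folklore] -/
theorem both_of (hNE : NoExcess) (hC : Conservation) :
    JacobianBudget.IsolatedJacobianDrop ∧ FrobeniusClosing.BoundedMilnor :=
  ⟨IsolatedJacobianDrop_of hNE hC, boundedMilnor_of_isolatedJacobianDrop (IsolatedJacobianDrop_of hNE hC)⟩

end Summit.ResolutionOfSingularities.ResolutionOfSingularities.Cruxes.BoundedMilnor.Lines.JacobianBudgetTransfer.Companion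

end
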